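import Summits.Parity.GeneralizedHardyLittlewood.Theorems.RomanoffHeathBrownAssembly
import Summits.Parity.GeneralizedHardyLittlewood.Theorems.RomanoffHeathBrownHBMassLower
import Summits.Parity.GeneralizedHardyLittlewood.Theorems.RomanoffHeathBrownSecondMomentReduction
import Summits.Parity.GeneralizedHardyLittlewood.Theorems.RomanoffHeathBrownSmallModuliCorrelation
import Summits.Parity.GeneralizedHardyLittlewood.Theorems.RomanoffHeathBrownLargeModuliCorrelation

/-! # RomanoffHeathBrown — the target: `goldbachHeathBrownPositiveDensity_proof :
GoldbachHeathBrownPositiveDensity` (item stmt-Parity-20271, rung F-P1c of Parity, D-0061)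

A positive proportion of the integers `n ≤ N` are even numbers of the form `p + (x³ + 2y³)` with
`p` and `x³ + 2y³` prime, `x, y ≥ 1`: the route's deciding theorem `closes` applied to the five proved
blocks — `SmallModuliCorrelation` (`romanoffHeathBrown_smallModuliCorrelation_proof`),
`LargeModuliCorrelation` (`romanoffHeathBrown_largeModuliCorrelation_proof`), `HBMassLower`
(`hbMassLower_proof`), `SecondMomentReduction` (`secondMomentReduction_proof`) and `Assembly`
(`assembly_proof`). Sources: [Romanoff1934], [Nathanson1996] (§7.6), [HeathBrownActa2001]. -/

namespace Summit.Parity.GeneralizedHardyLittlewood.Theses.RomanoffHeathBrown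

/-- **GoldbachHeathBrownPositiveDensity PROVED** (item stmt-Parity-20271, rung F-P1c): there are
`c₀ > 0` and `N₀` such that for all `N ≥ N₀` at least `c₀ N` even integers `n ≤ N` are
`p + (x³ + 2y³)` with `p` and `x³ + 2y³` prime, `x, y ≥ 1` — Romanoff's second-moment method for
`P + A`, `A` = the Heath-Brown primes. [this line] -/
theorem goldbachHeathBrownPositiveDensity_proof : GoldbachHeathBrownPositiveDensity :=
  closes assembly_proof
    Summit.Parity.GeneralizedHardyLittlewood.Theorems.RomanoffHeathBrown.romanoffHeathBrown_smallModuliCorrelation_proof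
    Summit.Parity.GeneralizedHardyLittlewood.Theorems.RomanoffHeathBrown.romanoffHeathBrown_largeModuliCorrelation_proof
    hbMassLower_proof secondMomentReduction_proof

end Summit.Parity.GeneralizedHardyLittlewood.Theses.RomanoffHeathBrown
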